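import Summits.Ventures.LatticeQCDFlow.Scoring.ChainLagProductACov
import Summits.Ventures.LatticeQCDFlow.Scoring.ChainTauIntWindowCLT
import Summits.Ventures.LatticeQCDFlow.Scoring.LagProductGaussianLimit

/-!
# NON-VACUITY for Markov-chain data: the asymptotic covariance matrix `Σ` of the chain's empirical
# autocovariances is positive semidefinite, `N(0, Σ)` realises the Gaussian limit, and the joint CLT /
# the `τ̂_W` CLT hold with THIS limit

HONEST FRAMING: exact (Metropolis-corrected) sampling algorithms for lattice gauge theory;
figures of merit are autocorrelation/cost numbers at stated couplings and volumes; no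
continuum-physics claim.

Venture `LatticeQCDFlow` (cell pub-lqcd), sub-topic `Scoring`; FANOUT row 16 (`su2-base`), GEN-9.
NEW WORK of the cell, not a published result; no definition; nothing is cited as a fact.  MARKOV-CHAIN
COUNTERPART of GEN-7's `Scoring/LagProductGaussianLimit` (block-factor processes): the CLTs of
`Scoring/ChainLagProductCLT` and `Scoring/ChainTauIntWindowCLT` are stated for an arbitrary random vector
`Z` with prescribed Gaussian projections `⟪a, Z⟫ ∼ N(0, windowLRVar κ π W (lagProdComb f̄ W a))`; this
file shows such a `Z` EXISTS, so those theorems are about an inhabited hypothesis.  By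
`Scoring/ChainLagProductACov` the variance functional is the quadratic form of the symmetric matrix
`Σ = chainLagACov κ π f̄ W` and is nonnegative; hence `Matrix.of Σ` is `PosSemidef`, and GEN-7's
`hasLaw_inner_multivariateGaussian` (Mathlib's `multivariateGaussian`) supplies the vector.

## Content (`κ` Markov, `π` invariant, `(nHit κ m)(z,·) ≥ ε ν` for all `z`, `ε ≠ 0`, `0 < m`; `|f| ≤ C`
## measurable, `f̄ = f − ∫ f dπ`; `μ₀` ANY initial law)

* **`posSemidef_chainLagACov_of_nHit`** — `Matrix.of (chainLagACov κ π g W)` is positive semidefinite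
  for every bounded measurable `g`;
* **`chain_gaussianLimit_realised`** — `Z = id` on `(ℝ^{W+1}, N(0, Σ))` satisfies the hypotheses `hZm`,
  `hZ` of the chain CLTs (`g = f̄`);
* **`tendstoInDistribution_chain_acovHat_multivariateGaussian`** — the joint CLT of the chain's
  empirical autocovariances with this concrete limit, from every initial law;
* **`tendstoInDistribution_chain_tauIntWindow_multivariateGaussian`** — THE FIXED-WINDOW LAW OF `τ̂_W`
  ON CHAIN DATA with the concrete limit: `√N (τ̂_W(N) − τ_W) ⇒ ⟪ℓ, Z⟫`, `Z ∼ N(0, Σ)`,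
  `⟪ℓ, Z⟫ ∼ N(0, ℓᵀ Σ ℓ)` (`hasLaw_chain_tauIntWindow_limit_quadForm`).

NOT CLAIMED: `Σ` positive definite / `ℓᵀΣℓ > 0` (false in general: `f` constant `π`-a.e.); uniqueness
in law of the limit (not needed); the scorers' centred `1/(N−t)` statistic; data-chosen windows.
-/

noncomputable section

open MeasureTheory ProbabilityTheory Filter Finset Preorder WithLp Matrix
open scoped ENNReal Topology RealInnerProductSpace
open Summit.Ventures.LatticeQCDFlow.Exactness Summit.Ventures.LatticeQCDFlow.Exactness.GeneralNCMC

namespace Summit.Ventures.LatticeQCDFlow.Scoring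

variable {S : Type*} [MeasurableSpace S]

section Realisation

variable (κ : Kernel S S) [IsMarkovKernel κ] (W : ℕ) {π : Measure S} [IsProbabilityMeasure π]
  {ν : Measure S} [IsProbabilityMeasure ν] {ε : ℝ≥0∞} {m : ℕ}

/-- **`Σ` is positive semidefinite** (symmetric by `chainLagACov_comm`; its quadratic form is a
long-run variance, `quadForm_chainLagACov_nonneg_of_nHit`). -/
theorem posSemidef_chainLagACov_of_nHit (hπ : Kernel.Invariant κ π) (hε : ε ≠ 0)
    (hmin : ∀ z, ε • ν ≤ nHit κ m z) (hm : 0 < m) {g : S → ℝ} (hg : Measurable g) {C : ℝ}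
    (hC : ∀ z, |g z| ≤ C) :
    (Matrix.of fun s t : Fin (W + 1) => chainLagACov κ π g W s t).PosSemidef := by
  refine PosSemidef.of_dotProduct_mulVec_nonneg (IsHermitian.ext fun i j => ?_) fun x => ?_
  · simp only [of_apply, star_trivial]
    exact chainLagACov_comm _ _ _ _ _ _
  · rw [star_trivial, dotProduct_mulVec_eq_sum]
    simpa only [of_apply, PiLp.toLp_apply] using
      quadForm_chainLagACov_nonneg_of_nHit κ W hπ hε hmin hm hg hC (toLp 2 x)

/-- **THE GAUSSIAN LIMIT IS REALISED**: for bounded measurable `g`, the identity on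
`(ℝ^{W+1}, N(0, Matrix.of (chainLagACov κ π g W)))` is an a.e.-measurable random vector `Z` with
`⟪a, Z⟫ ∼ N(0, windowLRVar κ π W (lagProdComb g W a))` for every `a` — the hypotheses `hZm`, `hZ` of
`tendstoInDistribution_chain_acovHat_of_nHit` / `tendstoInDistribution_chain_tauIntWindow_of_nHit`
(with `g = f̄`). -/
theorem chain_gaussianLimit_realised (hπ : Kernel.Invariant κ π) (hε : ε ≠ 0)
    (hmin : ∀ z, ε • ν ≤ nHit κ m z) (hm : 0 < m) {g : S → ℝ} (hg : Measurable g) {C : ℝ}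
    (hC : ∀ z, |g z| ≤ C) :
    AEMeasurable (id : EuclideanSpace ℝ (Fin (W + 1)) → EuclideanSpace ℝ (Fin (W + 1)))
        (multivariateGaussian 0 (Matrix.of fun s t : Fin (W + 1) => chainLagACov κ π g W s t))
      ∧ ∀ a : EuclideanSpace ℝ (Fin (W + 1)), HasLaw (fun z : EuclideanSpace ℝ (Fin (W + 1)) => ⟪a, z⟫)
        (gaussianReal 0 (windowLRVar κ π W (lagProdComb g W a)).toNNReal)
        (multivariateGaussian 0 (Matrix.of fun s t : Fin (W + 1) => chainLagACov κ π g W s t)) := by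
  refine ⟨aemeasurable_id, fun a => ?_⟩
  have h := hasLaw_inner_multivariateGaussian _ (posSemidef_chainLagACov_of_nHit κ W hπ hε hmin hm hg hC) a
  rw [← quadForm_chainLagACov_of_nHit κ W hπ hε hmin hm hg hC a]
  simpa only [of_apply] using h

/-- Bookkeeping: the centred observable `f̄ = f − ∫ f dπ` is measurable and bounded by `2C`. -/
theorem centred_measurable_bounded {f : S → ℝ} (hf : Measurable f) {C : ℝ} (hC : ∀ z, |f z| ≤ C) :
    Measurable (fun z => f z - ∫ z', f z' ∂π) ∧ ∀ z, |f z - ∫ z', f z' ∂π| ≤ 2 * C := by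
  refine ⟨hf.sub measurable_const, fun z => ?_⟩
  have hmean : |∫ z', f z' ∂π| ≤ C := by
    rw [← Real.norm_eq_abs]
    calc ‖∫ z', f z' ∂π‖ ≤ C * π.real Set.univ :=
          norm_integral_le_of_norm_le_const (Eventually.of_forall fun z => by
            rw [Real.norm_eq_abs]; exact hC z)
      _ = C := by rw [probReal_univ, mul_one]
  calc |f z - ∫ z', f z' ∂π| ≤ |f z| + |∫ z', f z' ∂π| := abs_sub _ _
    _ ≤ C + C := add_le_add (hC z) hmean
    _ = 2 * C := by ring

/-- **The joint CLT of the chain's empirical autocovariances with the concrete limit `N(0, Σ)`**,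
from every initial law. -/
theorem tendstoInDistribution_chain_acovHat_multivariateGaussian (hπ : Kernel.Invariant κ π)
    (hε : ε ≠ 0) (hmin : ∀ z, ε • ν ≤ nHit κ m z) (hm : 0 < m)
    {f : S → ℝ} (hf : Measurable f) {C : ℝ} (hC : ∀ z, |f z| ≤ C)
    (μ₀ : Measure S) [IsProbabilityMeasure μ₀]
    [IsProbabilityMeasure (Kernel.trajMeasure (X := fun _ : ℕ => S) μ₀
        (fun n : ℕ => κ.comap (fun hh : (i : ↥(Finset.Iic n)) → S => hh ⟨n, Finset.mem_Iic.2 le_rfl⟩)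
          (measurable_pi_apply _)))] :
    TendstoInDistribution
      (fun (N : ℕ) (x : ℕ → S) => Real.sqrt N
        • (toLp 2 (fun t : Fin (W + 1) =>
            acovHat (fun (i : ℕ) (x : ℕ → S) => f (x i) - ∫ z', f z' ∂π) N t x)
          - toLp 2 (fun t : Fin (W + 1) => autocov κ π (fun z => f z - ∫ z', f z' ∂π) t)))
      atTop (id : EuclideanSpace ℝ (Fin (W + 1)) → EuclideanSpace ℝ (Fin (W + 1)))
      (fun _ => Kernel.trajMeasure (X := fun _ : ℕ => S) μ₀
        (fun n : ℕ => κ.comap (fun hh : (i : ↥(Finset.Iic n)) → S => hh ⟨n, Finset.mem_Iic.2 le_rfl⟩)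
          (measurable_pi_apply _)))
      (multivariateGaussian 0 (Matrix.of fun s t : Fin (W + 1) =>
        chainLagACov κ π (fun z => f z - ∫ z', f z' ∂π) W s t)) := by
  obtain ⟨hgm, hgC⟩ := centred_measurable_bounded (π := π) hf hC
  obtain ⟨hZm, hZ⟩ := chain_gaussianLimit_realised κ W hπ hε hmin hm hgm hgC
  exact tendstoInDistribution_chain_acovHat_of_nHit κ hπ hε hmin hm hf hC W μ₀ hZm hZ

/-- **THE FIXED-WINDOW LAW OF `τ̂_W` ON MARKOV-CHAIN DATA WITH THE CONCRETE LIMIT**: under a Doeblin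
power, `Var_π f = C(0) ≠ 0`, from EVERY initial law,
`√N (τ̂_W(N) − τ_W) ⇒ ⟪ℓ, Z⟫` with `Z ∼ N(0, Σ)`, `ℓ = tauHatGrad W (C(t))_t`. -/
theorem tendstoInDistribution_chain_tauIntWindow_multivariateGaussian (hπ : Kernel.Invariant κ π)
    (hε : ε ≠ 0) (hmin : ∀ z, ε • ν ≤ nHit κ m z) (hm : 0 < m)
    {f : S → ℝ} (hf : Measurable f) {C : ℝ} (hC : ∀ z, |f z| ≤ C)
    (hσ : autocov κ π (fun z => f z - ∫ z', f z' ∂π) 0 ≠ 0)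
    (μ₀ : Measure S) [IsProbabilityMeasure μ₀]
    [IsProbabilityMeasure (Kernel.trajMeasure (X := fun _ : ℕ => S) μ₀
        (fun n : ℕ => κ.comap (fun hh : (i : ↥(Finset.Iic n)) → S => hh ⟨n, Finset.mem_Iic.2 le_rfl⟩)
          (measurable_pi_apply _)))] :
    TendstoInDistribution
      (fun (N : ℕ) (x : ℕ → S) => Real.sqrt N
        * (tauIntWindow (fun t => acovHat (fun (i : ℕ) (x : ℕ → S) => f (x i) - ∫ z', f z' ∂π) N t x
              / acovHat (fun (i : ℕ) (x : ℕ → S) => f (x i) - ∫ z', f z' ∂π) N 0 x) W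
          - tauIntWindow (fun t => autocov κ π (fun z => f z - ∫ z', f z' ∂π) t
              / autocov κ π (fun z => f z - ∫ z', f z' ∂π) 0) W))
      atTop (fun z : EuclideanSpace ℝ (Fin (W + 1)) => ⟪tauHatGrad W (toLp 2 fun t : Fin (W + 1) =>
        autocov κ π (fun z => f z - ∫ z', f z' ∂π) t), z⟫)
      (fun _ => Kernel.trajMeasure (X := fun _ : ℕ => S) μ₀
        (fun n : ℕ => κ.comap (fun hh : (i : ↥(Finset.Iic n)) → S => hh ⟨n, Finset.mem_Iic.2 le_rfl⟩)
          (measurable_pi_apply _)))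
      (multivariateGaussian 0 (Matrix.of fun s t : Fin (W + 1) =>
        chainLagACov κ π (fun z => f z - ∫ z', f z' ∂π) W s t)) := by
  obtain ⟨hgm, hgC⟩ := centred_measurable_bounded (π := π) hf hC
  obtain ⟨hZm, hZ⟩ := chain_gaussianLimit_realised κ W hπ hε hmin hm hgm hgC
  exact tendstoInDistribution_chain_tauIntWindow_of_nHit κ hπ hε hmin hm hf hC W hσ μ₀ hZm hZ

/-- **… and the law of the limit is `N(0, ℓᵀ Σ ℓ)`**: with `Σ = chainLagACov κ π f̄ W` and
`ℓ = tauHatGrad W (C(t))_t`, under `N(0, Σ)` the functional `z ↦ ⟪ℓ, z⟫` has law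
`gaussianReal 0 (Σ_s Σ_t ℓ_s ℓ_t Σ(s,t))`. -/
theorem hasLaw_chain_tauIntWindow_limit_quadForm (hπ : Kernel.Invariant κ π) (hε : ε ≠ 0)
    (hmin : ∀ z, ε • ν ≤ nHit κ m z) (hm : 0 < m) {g : S → ℝ} (hg : Measurable g) {C : ℝ}
    (hC : ∀ z, |g z| ≤ C) (c : EuclideanSpace ℝ (Fin (W + 1))) :
    HasLaw (fun z : EuclideanSpace ℝ (Fin (W + 1)) => ⟪tauHatGrad W c, z⟫)
      (gaussianReal 0 (∑ s : Fin (W + 1), ∑ t : Fin (W + 1),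
        tauHatGrad W c s * tauHatGrad W c t * chainLagACov κ π g W s t).toNNReal)
      (multivariateGaussian 0 (Matrix.of fun s t : Fin (W + 1) => chainLagACov κ π g W s t)) := by
  have h := hasLaw_inner_multivariateGaussian _ (posSemidef_chainLagACov_of_nHit κ W hπ hε hmin hm hg hC)
    (tauHatGrad W c)
  simpa only [of_apply] using h

end Realisation

end Summit.Ventures.LatticeQCDFlow.Scoring

end
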